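import Literature.Computability.MetaComplexity.ChenJinWilliams2019.SparseMagnification
import Literature.Computability.MetaComplexity.MCSP
import Literature.Computability.Complexity.PaulPippengerSzemerediTrotter1983LogStar
import Literature.Computability.MetaComplexity.ChenJinWilliams2019.SparseTCMagnificationAtMCSP
import Literature.Computability.Complexity.NPSubsetNTIME
import Literature.Computability.Complexity.PolyExistsNTIMEArith
import Literature.Computability.Complexity.EasyWitness
import Literature.Computability.Complexity.PlumbingBricks
import HarnessLib

/-!
# Chen–McKay–Murray–Williams 2019: weak circuit lower bounds for SPARSE nondeterministic
# languages versus `NEXP ⊄ P/poly` (Theorem 7, an EQUIVALENCE) and versus exponential lower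
# bounds for `NE` (Theorem 6), as named facts

Citation header. L. Chen, D. M. McKay, C. D. Murray, R. R. Williams, *Relations and Equivalences
Between Circuit Lower Bounds and Karp–Lipton Theorems*, 34th Computational Complexity Conference
(CCC 2019), LIPIcs 137, 30:1–30:21, doi:10.4230/LIPIcs.CCC.2019.30 [bib: `ChenMcKayMurrayWilliams2019`]
(open-access primary, held text key `paper:url-f899e7cc422d`; page/line references below are to that
text). Printed, verbatim:

* (p. 30:5, Theorem 7) *"NEXP ⊄ P/poly if and only if there exists an ε > 0 such that for every
  sufficiently small β > 0, there is a 2^{n^β}-sparse language L ∈ NTIME[2^{n^β}] without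
  n^{1+ε}-size circuits."* — followed by the remark *"It follows that an n^{1+ε}-size circuit lower
  bound for MCSP[2^{m/log⋆ m}] implies NEXP ⊄ P/poly."* (The size parameter is `2^{m/log⋆ m}` — the
  exponent is `m/log⋆ m`; the held text extraction flattens superscripts, "MCSP[2m/ log⋆m]", exactly
  as it flattens Theorem 7's "2nβ-sparse … NTIME[2nβ]" = `2^{n^β}`. The reading is forced: with
  `s(m) = 2^{m/log⋆ m} = 2^{o(m)}` the language `MCSP[s]` is `2^{O(s(m)·m)} = 2^{n^{o(1)}}`-sparse at
  `n = 2^m`, which is what Theorem 7 consumes, and p. 30:4 cites McKay–Murray–Williams [29] for the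
  same parameter, whose threshold `N·poly(s(m)) ≤ N^{1+ε}` likewise needs `s(m) = 2^{o(m)}`; the
  other reading `2^m/log⋆ m` exceeds Lupanov's bound `(1+o(1))·2^m/m`, making `MCSP[s]` eventually
  trivial.)
* (p. 30:4, Theorem 6, "Consequences of Weak Circuit Lower Bounds for Polynomially-Sparse NP
  Languages") *"Suppose there is an ε > 0, a c ≥ 1, and an n^c-sparse L ∈ NP without n^{1+ε}-size
  circuits. Then MA ⊂ i.o.-NP/O(log n), MA ⊆ i.o.-P^{NP[O(log n)]}, and NE ⊄ SIZE[2^{δ·n}] for some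
  δ > 0 (which implies NP ⊄ SIZE[n^k] for all k)."*; and (p. 30:4) *"Theorem 6 shows how a very weak
  lower bound (n^{1+ε}) for a sparse language L ∈ NP would imply an exponential-size lower bound for
  NE (note, the converse is easy to show)."*
* Proof of Theorem 7 (p. 30:15): (⇒) by padding an `NTIME[2^n]` language without `n^{2/β}`-size
  circuits down to a `2^{m^β}`-sparse `L' ∈ NTIME[2^{m^β}]` without `m²`-size circuits; (⇐) via the
  hardness-condensation Lemma 13 / NPRG Corollary 16 (p. 30:13–14, conclusions "for infinitely many
  n") and Impagliazzo–Kabanets–Wigderson.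

## Rendering (the same conventions as the tree's rendering of Chen–Jin–Williams 2019, Thm. 1.1,
## `ChenJinWilliams2019.SparseNPHardAt` / `thm11_circuit_NP`, whose vocabulary is reused)

(i) "`2^{n^β}`-sparse" is `ChenJinWilliams2019.IsSparse (ChenJinWilliams2019.expSparsity β)`
(`|L ∩ {0,1}ⁿ| ≤ ⌊2^{n^β}⌋` at every `n`; for an integer count this is the printed `≤ 2^{n^β}`);
"`n^c`-sparse" is `IsSparse (fun n => n ^ c)`.
(ii) "`L ∈ NTIME[2^{n^β}]`" is membership in the tree's verifier-form `NTIME (subexpTime β)` with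
`subexpTime β n = ⌈2^{n^β}⌉` (the class is `O(·)`-robust by definition: witness length and
verification time `c·t(n)+c`).
(iii) "without `n^{1+ε}`-size circuits" is the ROBUST lower bound `∀ c, L ∉ SIZE(c·⌈n^{1+ε}⌉ + c)`
(`ChenJinWilliams2019.superlinearBound ε c`; per-language constants, fan-in-two basis `B₂` =
the paper's circuits up to a constant factor), and "`NE ⊄ SIZE[2^{δ·n}]`" is
`∃ L ∈ NE, ∀ c, L ∉ SIZE(c·⌈2^{δ n}⌉ + c)` (`expLinSizeBound δ c`). As in the tree's CJW19 file,
the printed `L ∉ SIZE[s]` is read as the infinitely-often lower bound the proofs deliver (Lemma 13: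
"for infinitely many n"); the everywhere-`SIZE` reading would be degenerate at small `n`.
(iv) Why each named fact is implied by print. In `thm7_magnification` and `thm6_NE` / `thm6_NP`
the robust hypothesis (iii) is STRONGER than the printed one (take `c = 1`), so the facts are weaker
than print. In `thm7_converse` the robust CONCLUSION at `ε/2` follows from the printed conclusion at
`ε` (an i.o. lower bound `> n^{1+ε}` beats `c·⌈n^{1+ε/2}⌉ + c` on all large lengths), and the fact
only asserts `∃ ε > 0`; likewise `NE ⊄ SIZE[2^{δ n}]` at `δ` gives the robust form at `δ/2`, and
"`NP ⊄ SIZE[n^k]` for all k" at `k+1` gives `ChenJinWilliams2019.NPNotInFixedPolySize` at `k`.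
"For every sufficiently small β > 0" is `∃ β₀ > 0, ∀ β ∈ (0, β₀)`.

What is here: the Theorem-7 hypothesis `SparseNSubexpHardAt ε`, both printed directions of
Theorem 7 as named facts (`thm7_magnification`, `thm7_converse`) and their conjunction as a proved
`iff`; the `MCSP[2^{m/log⋆ m}]` remark after Theorem 7 as a named fact (`thm7_MCSP_remark`, over
the tree's iterated logarithm `Complexity.logStar` and `MCSPSize`; rendering (v) below) together with
the PROVED half of its derivation from Theorem 7 — `MCSP[2^{⌊m/log⋆ m⌋}]` is eventually
`2^{n^β}`-sparse for EVERY `β > 0` (`MCSPSize_logStarExpSize_eventually_sparse`, from the tree's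
circuit count `ChenJinWilliams2019.ncard_slice_MCSPSize_le` and `tendsto_logStar_atTop`) and the
PROVED instantiation template `sparseNSubexpHardAt_of_mem_NP` (a language in `NP`, eventually
`2^{n^β}`-sparse for every `β ∈ (0,1)` and robustly outside `SIZE[n^{1+ε}]`, witnesses
`SparseNSubexpHardAt ε` — via the toolkit `NP_subset_NTIME_of_poly_dominated` /
`NP_subset_NTIME_subexpTime` (`NP ⊆ NTIME[2^{n^β}]` in the tree's verifier form, no
constructibility needed), `forall_not_mem_SIZE_superlinearBound_of_agree` (robust hardness ignores
finitely many lengths) and `isSparse_restrict`), whence `thm7_MCSP_remark_of_thm7` — the remark IS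
Theorem 7 (⇐) given `MCSP[2^{⌊m/log⋆ m⌋}] ∈ NP`, which is then PROVED
(`MCSPSize_logStarExpSize_mem_NP`, through a polynomial-time `log⋆` brick `logStarFn` built from
the tree's counted-iteration bricks — so the vendored remark is now DERIVED from Theorem 7:
`thm7_MCSP_remark_of_thm7_holds : thm7_magnification → thm7_MCSP_remark`) — and the dyadic
variant `thm7_at_MCSP_dyadic` (hardness of every `MCSP[2^{⌊m/2^j⌋}]` gives `NEXP ⊄ P/poly` from
`thm7_magnification` alone); the `NE` and
`NP` conclusions of Theorem 6 as named facts (`thm6_NE`, `thm6_NP`); proved monotonicity /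
inhabitedness lemmas. Deliberately NOT here: the two `MA` collapses of Theorem 6 (advice classes
`i.o.-NP/O(log n)`, `i.o.-P^{NP[O(log n)]}` are not in the tree) and the "easy converse" of
Theorem 6 (not stated as a theorem in print).
(v) "MCSP[2^{m/log⋆ m}]" is `MCSPSize logStarExpSize` with `logStarExpSize m = 2^{⌊m / log⋆ m⌋}`
(`log⋆` = the tree's iterated binary logarithm `Complexity.logStar`, `log⋆ m = 0` for `m ≤ 1`, where
`⌊m/0⌋ = 0` gives size `1`); print leaves the rounding of the exponent implicit and the tree's
`MCSPSize s` is the set of truth tables (length `n = 2^m`) of `m`-variable functions of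
`B₂`-circuit size `≤ s m` (Kabanets–Cai / Murray–Williams convention, `MCSP.lean`). "An
n^{1+ε}-size circuit lower bound" is `∃ ε > 0, ∀ c, MCSP[s] ∉ SIZE(c·⌈n^{1+ε}⌉ + c)` as in (iii).
-/

namespace Literature.Computability.MetaComplexity.ChenMcKayMurrayWilliams2019

open Complexity Complexity.Nondeterministic ChenJinWilliams2019
open Filter

/-! ### Size and time functions -/

/-- The time bound `n ↦ ⌈2^{n^β}⌉` rendering the printed "`NTIME[2^{n^β}]`" (module docstring (ii)).
[cite: ChenMcKayMurrayWilliams2019, Thm. 7] -/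
noncomputable def subexpTime (β : ℝ) : ℕ → ℕ := fun n => ⌈(2 : ℝ) ^ ((n : ℝ) ^ β)⌉₊

/-- The robust exponential size bound `n ↦ c·⌈2^{δ n}⌉ + c` rendering the printed "`SIZE[2^{δ·n}]`"
up to the per-language constant (module docstring (iii)). [cite: ChenMcKayMurrayWilliams2019, Thm. 6] -/
noncomputable def expLinSizeBound (δ : ℝ) (c : ℕ) : ℕ → ℕ :=
  fun n => c * ⌈(2 : ℝ) ^ (δ * (n : ℝ))⌉₊ + c

/-- `1 ≤ ⌈2^{n^β}⌉`: the time bound is never zero. [folklore] -/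
theorem one_le_subexpTime (β : ℝ) (n : ℕ) : 1 ≤ subexpTime β n := by
  have h : (1 : ℝ) ≤ (2 : ℝ) ^ ((n : ℝ) ^ β) :=
    Real.one_le_rpow one_le_two (Real.rpow_nonneg (Nat.cast_nonneg n) β)
  have h' : (1 : ℝ) ≤ (⌈(2 : ℝ) ^ ((n : ℝ) ^ β)⌉₊ : ℝ) := h.trans (Nat.le_ceil _)
  unfold subexpTime
  exact_mod_cast h'

/-- `c ≤ c·⌈2^{δ n}⌉ + c`. [folklore] -/
theorem le_expLinSizeBound (δ : ℝ) (c n : ℕ) : c ≤ expLinSizeBound δ c n :=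
  Nat.le_add_left c _

/-- The size classes `SIZE(c·⌈2^{δ n}⌉ + c)` grow with `c`. [folklore] -/
theorem SIZE_expLinSizeBound_mono (δ : ℝ) {c c' : ℕ} (h : c ≤ c') :
    SIZE (expLinSizeBound δ c) ⊆ SIZE (expLinSizeBound δ c') :=
  SIZE_mono fun _ => Nat.add_le_add (Nat.mul_le_mul_right _ h) h

/-- INHABITEDNESS of the conclusion's size classes in `thm6_NE`: for `1 ≤ c` the empty language
lies in `SIZE(c·⌈2^{δ n}⌉ + c)` (one constant gate), so `L ∉ SIZE(expLinSizeBound δ c)` is a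
genuine circuit lower bound, not membership failure in an empty class. [folklore] -/
theorem zero_mem_SIZE_expLinSizeBound (δ : ℝ) {c : ℕ} (hc : 1 ≤ c) :
    (0 : Language Bool) ∈ SIZE (expLinSizeBound δ c) := by
  refine ⟨fun n => Circuit.const (Fin n) false, fun n => ⟨?_, ?_⟩, fun x => ?_⟩
  · intro g hg
    have hg' : g = ⟨0, fun _ => false, Fin.elim0⟩ := List.mem_singleton.1 hg
    subst hg'
    show (0 : ℕ) ≤ 2
    exact Nat.zero_le 2
  · exact hc.trans (le_expLinSizeBound δ c n)
  · exact ((Set.notMem_iff_boolIndicator (0 : Language Bool) x).1 (Language.notMem_zero x)).symm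

/-! ### Theorem 7: the hypothesis and the two printed directions -/

/-- The HYPOTHESIS of Theorem 7 at a fixed `ε`: *"for every sufficiently small β > 0, there is a
2^{n^β}-sparse language L ∈ NTIME[2^{n^β}] without n^{1+ε}-size circuits"* — rendered
`∃ β₀ > 0, ∀ β ∈ (0, β₀), ∃ L ∈ NTIME(⌈2^{n^β}⌉), |L ∩ {0,1}ⁿ| ≤ 2^{n^β} ∀ n, ∀ c, L ∉ SIZE(c·⌈n^{1+ε}⌉ + c)`
(module docstring (i)–(iii)). [cite: ChenMcKayMurrayWilliams2019, Thm. 7] -/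
def SparseNSubexpHardAt (ε : ℝ) : Prop :=
  ∃ β₀ : ℝ, 0 < β₀ ∧ ∀ β : ℝ, 0 < β → β < β₀ →
    ∃ L : Language Bool, L ∈ NTIME (subexpTime β) ∧ IsSparse (expSparsity β) L ∧
      ∀ c : ℕ, L ∉ SIZE (superlinearBound ε c)

/-- **Chen–McKay–Murray–Williams 2019, Theorem 7, direction (⇐) — hardness magnification from any
hard subexponentially-sparse `NTIME[2^{n^{o(1)}}]` language to `NEXP ⊄ P/poly`.** Printed (p. 30:5):
*"NEXP ⊄ P/poly if … there exists an ε > 0 such that for every sufficiently small β > 0, there is a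
2^{n^β}-sparse language L ∈ NTIME[2^{n^β}] without n^{1+ε}-size circuits."* The robust hypothesis is
stronger than the printed one (module docstring (iv)), so this fact is implied by print.
[cite: ChenMcKayMurrayWilliams2019, Thm. 7 (⇐), p. 30:5 and proof p. 30:15] -/
def thm7_magnification : Prop :=
  (∃ ε : ℝ, 0 < ε ∧ SparseNSubexpHardAt ε) → ¬ (NEXP ⊆ PPoly)

/-- **Chen–McKay–Murray–Williams 2019, Theorem 7, direction (⇒).** Printed (p. 30:5): *"NEXP ⊄ P/poly
… only if there exists an ε > 0 such that for every sufficiently small β > 0, there is a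
2^{n^β}-sparse language L ∈ NTIME[2^{n^β}] without n^{1+ε}-size circuits"* (proof, p. 30:15: pad an
`NTIME[2^n]` language without `n^{2/β}`-size circuits). The robust conclusion at `ε/2` follows from
the printed one at `ε` (module docstring (iv)); the fact asserts only `∃ ε > 0`.
[cite: ChenMcKayMurrayWilliams2019, Thm. 7 (⇒), p. 30:5 and proof p. 30:15] -/
def thm7_converse : Prop :=
  ¬ (NEXP ⊆ PPoly) → ∃ ε : ℝ, 0 < ε ∧ SparseNSubexpHardAt ε

/-- The two printed directions together: Theorem 7 as an `iff` between the sparse-`NTIME` hardness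
hypothesis (at some `ε > 0`) and `NEXP ⊄ P/poly`. [cite: ChenMcKayMurrayWilliams2019, Thm. 7] -/
theorem sparseNSubexpHard_iff (h : thm7_magnification) (h' : thm7_converse) :
    (∃ ε : ℝ, 0 < ε ∧ SparseNSubexpHardAt ε) ↔ ¬ (NEXP ⊆ PPoly) :=
  ⟨h, h'⟩

/-- Monotonicity in `ε`: the Theorem-7 hypothesis at `ε` implies it at every `ε' ∈ [0, ε]` (the size
classes `SIZE(c·⌈n^{1+ε'}⌉ + c) ⊆ SIZE(c·⌈n^{1+ε}⌉ + c)` shrink). [folklore] -/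
theorem SparseNSubexpHardAt.mono {ε ε' : ℝ} (hε' : 0 ≤ ε') (h : ε' ≤ ε)
    (hH : SparseNSubexpHardAt ε) : SparseNSubexpHardAt ε' := by
  obtain ⟨β₀, hβ₀, hβ⟩ := hH
  refine ⟨β₀, hβ₀, fun β hβ0 hβ1 => ?_⟩
  obtain ⟨L, hNT, hsp, hL⟩ := hβ β hβ0 hβ1
  refine ⟨L, hNT, hsp, fun c hc => hL c (SIZE_mono (fun n => ?_) hc)⟩
  -- `c·⌈n^{1+ε'}⌉ + c ≤ c·⌈n^{1+ε}⌉ + c`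
  refine Nat.add_le_add (Nat.mul_le_mul_left c (Nat.ceil_le_ceil ?_)) le_rfl
  rcases Nat.eq_zero_or_pos n with hn | hn
  · subst hn
    have h1 : (1 : ℝ) + ε' ≠ 0 := by linarith
    have h2 : (1 : ℝ) + ε ≠ 0 := by linarith
    simp [Real.zero_rpow h1, Real.zero_rpow h2]
  · exact Real.rpow_le_rpow_of_exponent_le (by exact_mod_cast hn) (by linarith)

/-- Monotonicity in the threshold `β₀`: shrinking the range of "sufficiently small β" preserves the
hypothesis (definitional bookkeeping). [folklore] -/
theorem SparseNSubexpHardAt.of_forall {ε β₀ : ℝ} (hβ₀ : 0 < β₀)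
    (h : ∀ β : ℝ, 0 < β → β < β₀ →
      ∃ L : Language Bool, L ∈ NTIME (subexpTime β) ∧ IsSparse (expSparsity β) L ∧
        ∀ c : ℕ, L ∉ SIZE (superlinearBound ε c)) :
    SparseNSubexpHardAt ε :=
  ⟨β₀, hβ₀, h⟩

/-! ### The `MCSP[2^{m/log⋆ m}]` remark after Theorem 7 -/

/-- The size function `m ↦ 2^{⌊m / log⋆ m⌋}` of the printed "`MCSP[2^{m/log⋆ m}]`" (module docstring
(v); `log⋆ 0 = log⋆ 1 = 0` and `⌊m/0⌋ = 0`, so the first two values are `1`).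
[cite: ChenMcKayMurrayWilliams2019, remark after Thm. 7, p. 30:5] -/
def logStarExpSize : ℕ → ℕ := fun m => 2 ^ (m / logStar m)

/-- `1 ≤ 2^{⌊m / log⋆ m⌋}`. [folklore] -/
theorem one_le_logStarExpSize (m : ℕ) : 1 ≤ logStarExpSize m := Nat.one_le_two_pow

/-- `2^{⌊m / log⋆ m⌋} ≤ 2^m`: the size parameter never exceeds the trivial `2^m`. [folklore] -/
theorem logStarExpSize_le_two_pow (m : ℕ) : logStarExpSize m ≤ 2 ^ m :=
  Nat.pow_le_pow_right (by norm_num) (Nat.div_le_self m _)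

/-- **Chen–McKay–Murray–Williams 2019, the remark after Theorem 7 (p. 30:5).** Printed: *"It follows
that an n^{1+ε}-size circuit lower bound for MCSP[2^{m/log⋆ m}] implies NEXP ⊄ P/poly."* Rendered
with the robust lower bound of (iii) for the language `MCSPSize logStarExpSize` (rendering (v)): if
for some `ε > 0` and every `c`, `MCSP[2^{⌊m/log⋆ m⌋}] ∉ SIZE(c·⌈n^{1+ε}⌉ + c)`, then `NEXP ⊄ P/poly`.
(In print this is a corollary of Theorem 7 (⇐): `MCSP[2^{m/log⋆ m}]` is in `NP` and
`2^{n^{o(1)}}`-sparse; the sparsity half of that derivation is PROVED below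
(`MCSPSize_logStarExpSize_eventually_sparse`) and so is `NP ⊆ NTIME[2^{n^β}]`
(`NP_subset_NTIME_subexpTime`) and so is `MCSP[2^{⌊m/log⋆ m⌋}] ∈ NP`
(`MCSPSize_logStarExpSize_mem_NP`): `thm7_MCSP_remark_of_thm7_holds` DERIVES this fact from
`thm7_magnification`; it stays a named `Prop` because the census row R63 consumes it by name.)
[cite: ChenMcKayMurrayWilliams2019, remark after Thm. 7, p. 30:5 (L14–15 of the held text)] -/
def thm7_MCSP_remark : Prop :=
  (∃ ε : ℝ, 0 < ε ∧ ∀ c : ℕ, MCSPSize logStarExpSize ∉ SIZE (superlinearBound ε c)) →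
    ¬ (NEXP ⊆ PPoly)

/-! ### The remark's language is `2^{n^{o(1)}}`-sparse (PROVED)

Why `MCSP[2^{m/log⋆ m}]` fits Theorem 7's template "`2^{n^β}`-sparse for every sufficiently small
`β`": at length `n = 2^m` the language has at most `(s+1)(16(m+s+1)²)^s(m+s+1) ≤ 2^{15 s² m}` members
(`s = 2^{⌊m/log⋆ m⌋}`, the tree's `ChenJinWilliams2019.ncard_slice_MCSPSize_le` /
`count_le_two_pow`), and `15 m · 2^{2m/log⋆ m} ≤ 2^{βm/2} · 2^{βm/2} = 2^{βm} = (2^m)^β … ≤`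
exponent of `⌊2^{n^β}⌋` as soon as `log⋆ m ≥ 4/β` (`tendsto_logStar_atTop`) and `15 m ≤ 2^{βm/2}`.
This is also the arithmetic behind module-docstring rendering (v): with the OTHER reading
`2^m/log⋆ m` of the flattened superscript the parameter would exceed every `m`-ary function's circuit
complexity for large `m` (Lupanov), the language would contain all long truth tables, and no
`2^{n^β}`-sparsity with `β < 1` could hold. -/

/-- **Slice count, PROVED.** For every `β > 0` and all large `m`:
`|MCSP[2^{⌊m/log⋆ m⌋}] ∩ {0,1}^{2^m}| ≤ ⌊2^{(2^m)^β}⌋` (`= ChenJinWilliams2019.expSparsity β (2^m)`).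
[folklore] -/
theorem ncard_slice_MCSPSize_logStarExpSize_le (β : ℝ) (hβ : 0 < β) :
    ∀ᶠ m : ℕ in atTop,
      {x : List Bool | x ∈ MCSPSize logStarExpSize ∧ x.length = 2 ^ m}.ncard ≤
        expSparsity β (2 ^ m) := by
  filter_upwards [fifteen_mul_le_two_rpow (half_pos hβ), eventually_ge_atTop 1,
    tendsto_logStar_atTop.eventually_ge_atTop ⌈4 / β⌉₊] with m hm15 hm1 hL
  have hsdef : logStarExpSize m = 2 ^ (m / logStar m) := rfl
  set s := logStarExpSize m with hs
  have hs1 : 1 ≤ s := hsdef ▸ Nat.one_le_two_pow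
  refine (ncard_slice_MCSPSize_le _ m).trans ((count_le_two_pow m s hm1 hs1).trans (Nat.le_floor ?_))
  rw [cast_two_pow_rpow, Nat.cast_pow, Nat.cast_ofNat, ← Real.rpow_natCast]
  refine Real.rpow_le_rpow_of_exponent_le one_le_two ?_
  have hj : 4 / β ≤ (logStar m : ℝ) := (Nat.le_ceil _).trans (by exact_mod_cast hL)
  have h2j : (0 : ℝ) < (logStar m : ℝ) := lt_of_lt_of_le (by positivity) hj
  have hratio : 2 * (m : ℝ) / (logStar m : ℝ) ≤ β / 2 * m := by
    have h4 : 4 ≤ β * (logStar m : ℝ) := by rwa [div_le_iff₀ hβ, mul_comm] at hj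
    rw [div_le_iff₀ h2j]
    have hm0 : (0 : ℝ) ≤ m := Nat.cast_nonneg m
    nlinarith
  have hsq : ((s ^ 2 : ℕ) : ℝ) ≤ (2 : ℝ) ^ (β / 2 * m) := by
    have hdiv : ((m / logStar m : ℕ) : ℝ) ≤ (m : ℝ) / (logStar m : ℝ) := by
      have h := Nat.cast_div_le (m := m) (n := logStar m) (α := ℝ)
      simpa using h
    calc ((s ^ 2 : ℕ) : ℝ) = (2 : ℝ) ^ (((2 * (m / logStar m) : ℕ) : ℝ)) := by
          rw [Real.rpow_natCast, hsdef, ← pow_mul, mul_comm]; push_cast; ring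
      _ ≤ (2 : ℝ) ^ (β / 2 * m) := by
          refine Real.rpow_le_rpow_of_exponent_le one_le_two ?_
          push_cast
          have : 2 * ((m / logStar m : ℕ) : ℝ) ≤ 2 * (m : ℝ) / (logStar m : ℝ) := by
            rw [mul_div_assoc]; exact mul_le_mul_of_nonneg_left hdiv zero_le_two
          exact this.trans hratio
  have hpow_nonneg : (0 : ℝ) ≤ (2 : ℝ) ^ (β / 2 * m) := by positivity
  calc ((15 * s ^ 2 * m : ℕ) : ℝ) = (15 * m : ℝ) * ((s ^ 2 : ℕ) : ℝ) := by push_cast; ring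
    _ ≤ (2 : ℝ) ^ (β / 2 * m) * (2 : ℝ) ^ (β / 2 * m) :=
        mul_le_mul hm15 hsq (by positivity) hpow_nonneg
    _ = (2 : ℝ) ^ (β * m) := by rw [← Real.rpow_add two_pos]; ring_nf

/-- **Eventual `2^{n^β}`-sparsity of `MCSP[2^{⌊m/log⋆ m⌋}]` for every `β > 0`, PROVED**: at all
large lengths `N` (powers of two by the slice count, other lengths have empty slices) the slice has
at most `⌊2^{N^β}⌋` elements — the "`2^{n^{o(1)}}`-sparse" of the remark after Theorem 7
(p. 30:5 L17–18 of the held text; referee F29).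
[folklore] -/
theorem MCSPSize_logStarExpSize_eventually_sparse (β : ℝ) (hβ : 0 < β) :
    ∀ᶠ N : ℕ in atTop,
      {x : List Bool | x ∈ MCSPSize logStarExpSize ∧ x.length = N}.ncard ≤ expSparsity β N := by
  obtain ⟨m₀, hm₀⟩ := eventually_atTop.1 (ncard_slice_MCSPSize_logStarExpSize_le β hβ)
  refine eventually_atTop.2 ⟨2 ^ m₀, fun N hN => ?_⟩
  by_cases hpow : ∃ n : ℕ, N = 2 ^ n
  · obtain ⟨n, rfl⟩ := hpow
    have hn : m₀ ≤ n := by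
      by_contra hlt
      exact absurd hN (not_le.2 (Nat.pow_lt_pow_right (by norm_num) (not_le.1 hlt)))
    exact hm₀ n hn
  · push Not at hpow
    rw [slice_MCSPSize_eq_empty (s := logStarExpSize) hpow, Set.ncard_empty]
    exact Nat.zero_le _

/-! ### Theorem 6: the `NE` and `NP` conclusions -/

/-- The HYPOTHESIS of Theorem 6 at fixed `ε` and sparsity exponent `c`: *"an n^c-sparse L ∈ NP
without n^{1+ε}-size circuits"*, with the robust lower bound (module docstring (iii)).
[cite: ChenMcKayMurrayWilliams2019, Thm. 6] -/
def PolySparseNPHardAt (ε : ℝ) (c : ℕ) : Prop :=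
  ∃ L : Language Bool, L ∈ NP ∧ IsSparse (fun n => n ^ c) L ∧
    ∀ c' : ℕ, L ∉ SIZE (superlinearBound ε c')

/-- "`NE ⊄ SIZE[2^{δ·n}]` for some `δ > 0`", rendered robustly: some `NE` language has circuit
complexity not `O(2^{δ n})` — `∃ δ > 0, ∃ L ∈ NE, ∀ c, L ∉ SIZE(c·⌈2^{δ n}⌉ + c)` (module docstring
(iii)–(iv)). [cite: ChenMcKayMurrayWilliams2019, Thm. 6] -/
def NENotInSomeExpSize : Prop :=
  ∃ δ : ℝ, 0 < δ ∧ ∃ L : Language Bool, L ∈ NE ∧ ∀ c : ℕ, L ∉ SIZE (expLinSizeBound δ c)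

/-- **Chen–McKay–Murray–Williams 2019, Theorem 6 (the `NE` conclusion).** Printed (p. 30:4):
*"Suppose there is an ε > 0, a c ≥ 1, and an n^c-sparse L ∈ NP without n^{1+ε}-size circuits. Then
… NE ⊄ SIZE[2^{δ·n}] for some δ > 0"*. Hypothesis robust (stronger than print), conclusion robust at
`δ/2` (module docstring (iv)). [cite: ChenMcKayMurrayWilliams2019, Thm. 6, p. 30:4] -/
def thm6_NE : Prop :=
  ∀ ε : ℝ, 0 < ε → ∀ c : ℕ, 1 ≤ c → PolySparseNPHardAt ε c → NENotInSomeExpSize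

/-- **Chen–McKay–Murray–Williams 2019, Theorem 6 (the `NP` conclusion).** Printed (p. 30:4): under
the same hypothesis, *"NE ⊄ SIZE[2^{δ·n}] for some δ > 0 (which implies NP ⊄ SIZE[n^k] for all k)"*;
the conclusion is the tree's robust `ChenJinWilliams2019.NPNotInFixedPolySize`
(`∀ k, ∃ L ∈ NP, ∀ c, L ∉ SIZE(c·n^k + c)`, implied by the printed form at `k+1`).
[cite: ChenMcKayMurrayWilliams2019, Thm. 6, p. 30:4] -/
def thm6_NP : Prop :=
  ∀ ε : ℝ, 0 < ε → ∀ c : ℕ, 1 ≤ c → PolySparseNPHardAt ε c → NPNotInFixedPolySize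

/-- Monotonicity of the Theorem-6 hypothesis in the sparsity exponent (`n^c ≤ n^{c'}` for `c ≤ c'`,
`1 ≤ n`; at `n = 0` both bounds are `0^c`, handled by cases). [folklore] -/
theorem PolySparseNPHardAt.mono_exp {ε : ℝ} {c c' : ℕ} (hc : 1 ≤ c) (h : c ≤ c')
    (hH : PolySparseNPHardAt ε c) : PolySparseNPHardAt ε c' := by
  obtain ⟨L, hNP, hsp, hL⟩ := hH
  refine ⟨L, hNP, hsp.mono fun n => ?_, hL⟩
  rcases Nat.eq_zero_or_pos n with hn | hn
  · subst hn
    have hc' : c' ≠ 0 := by omega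
    have hc0 : c ≠ 0 := by omega
    simp [Nat.zero_pow (Nat.pos_of_ne_zero hc0), Nat.zero_pow (Nat.pos_of_ne_zero hc')]
  · exact Nat.pow_le_pow_right hn h

/-! ### From Theorem 7 to its MCSP instances (PROVED toolkit)

CMMW derive the `MCSP` remark from Theorem 7 (⇐) in one sentence (remark after Thm. 7, p. 30:5
L17–18; referee F29): the language is in
`NP ⊆ NTIME[2^{n^β}]` and `2^{n^{o(1)}}`-sparse. In the tree's renderings this needs three
proved ingredients, all [folklore]: (1) `NP ⊆ NTIME t` for any `t` dominating every polynomial up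
to a constant (`NP_subset_NTIME_of_poly_dominated` — the proof of the tree's
`NP_subset_NTIME_two_pow` verbatim with `2ⁿ` replaced by `t n`: the verifier's clock is polynomial
in the input, so no time-constructibility of `t` is used), in particular `NP ⊆ NTIME (subexpTime β)`
for every `β > 0` (`exists_poly_le_subexpTime` through `PolyExistsNTIME.exists_poly_le_two_pow_nthRoot`
at `r = ⌈1/β⌉`); (2) robust hardness `∀ c, L ∉ SIZE(c·⌈n^{1+ε}⌉ + c)` passes to any language agreeing
with `L` at all large lengths (`forall_not_mem_SIZE_superlinearBound_of_agree`, absorbing the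
finitely many small circuit sizes into `c`, via `mem_SIZE_iff_circuitSize_le_holds` and
`circuitSize_congr_of_agree`); (3) restricting an
eventually-sparse language to long lengths makes it sparse at EVERY length (`isSparse_restrict`) and
keeps it in `NP` (`inter_P_mem_NP`). -/

section Toolkit
open _root_.Computability Turing Polynomial
open Literature.Computability.Complexity.Brick Literature.Computability.Complexity.Plumb

/-- **`NP ⊆ NTIME t` whenever every polynomial is `O(t)`**, in the tree's one-constant verifier
form of `NTIME` and with NO time-constructibility assumption on `t`: the proof of
`NP_subset_NTIME_two_pow` (`NPSubsetNTIME.lean`) verbatim with `2ⁿ` replaced by `t n` — the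
verifier cuts the witness at the polynomial length `p(|x|) + 1` with a polynomial clock and decides
`LenLe p ⊓ L'`; only the final domination of that polynomial cost by `b · t n + b` changes.
[cite: AroraBarak2009, Thm. 2.6] -/
theorem NP_subset_NTIME_of_poly_dominated {t : ℕ → ℕ}
    (hdom : ∀ q : Polynomial ℕ, ∃ b : ℕ, ∀ n, q.eval n ≤ b * t n + b) :
    NP ⊆ NTIME t := by
  rintro L ⟨L', hL'P, p, hL⟩
  have hL'' : LenLe p ⊓ L' ∈ Classes.P := inter_mem_P (LenLe_mem_P p) hL'P
  simp only [Classes.P, Set.mem_iUnion] at hL''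
  obtain ⟨k, a, hdec⟩ := hL''
  obtain ⟨M, hM⟩ := (hdec : TimeDecidable id (LenLe p ⊓ L') fun n => a * n ^ k + a)
  obtain ⟨q, N, hN⟩ := exists_machine_pair_ones p
  obtain ⟨b, hb⟩ := hdom (q + 5 * X + 13 + 2 * (p + 1) + (C a * (2 * X + 3 + p) ^ k + C a))
  let V : TM2ComputableAux Bool Bool := (truncMapAux N).comp M
  refine ⟨2 * b + 2,
    fun x y => (LenLe p ⊓ L').boolIndicator (boolPair x (y.take (p.eval x.length + 1))), V,
    fun x y hy => ?_, fun x => ?_⟩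
  · have h₁ := outputsWithin_truncMapAux_boolPair N (y := y) (hN x)
    simp only [List.length_replicate] at h₁
    set y' := y.take (p.eval x.length + 1) with hy'
    have hlen' : y'.length ≤ p.eval x.length + 1 := List.length_take_le _ _
    have h₂ : M.OutputsWithin (boolPair x y') (encodeBool ((LenLe p ⊓ L').boolIndicator
        (boolPair x y'))) (a * (2 * x.length + 3 + p.eval x.length) ^ k + a) := by
      refine (hM (boolPair x y')).mono ?_
      simp only [id, length_boolPair]
      have : 2 * x.length + 2 + y'.length ≤ 2 * x.length + 3 + p.eval x.length := by omega
      exact Nat.add_le_add_right (Nat.mul_le_mul_left a (Nat.pow_le_pow_left this k)) a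
    have h := Turing.TM2ComputableAux.comp_outputsWithin _ _ h₁ h₂
    refine h.mono ?_
    have hbn := hb x.length
    simp only [eval_add, eval_mul, eval_ofNat, eval_X, eval_pow, eval_C, eval_one] at hbn
    have hy2 : 2 * (y.length / 2) ≤ (2 * b + 2) * t x.length + (2 * b + 2) :=
      (Nat.mul_div_le y.length 2).trans hy
    nlinarith [hbn, hy2]
  · have hind : ∀ w : List Bool, (LenLe p ⊓ L').boolIndicator w = true ↔ w ∈ LenLe p ∧ w ∈ L' :=
      fun w => (Set.mem_iff_boolIndicator ((LenLe p ⊓ L' : Language Bool) : Set (List Bool)) w).symm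
    rw [hL x]
    constructor
    · rintro ⟨y₀, hy₀, hmem⟩
      refine ⟨y₀, ?_, ?_⟩
      · have hbn := hb x.length
        simp only [eval_add, eval_mul, eval_ofNat, eval_X, eval_pow, eval_C,
          eval_one] at hbn
        show y₀.length ≤ (2 * b + 2) * t x.length + (2 * b + 2)
        calc y₀.length ≤ p.eval x.length := hy₀
          _ ≤ b * t x.length + b := by omega
          _ ≤ (2 * b + 2) * t x.length + (2 * b + 2) :=
              Nat.add_le_add (Nat.mul_le_mul_right _ (by omega)) (by omega)
      · rw [hind, List.take_of_length_le (by omega), boolPair_mem_LenLe]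
        exact ⟨hy₀, hmem⟩
    · rintro ⟨y, -, hR⟩
      rw [hind, boolPair_mem_LenLe] at hR
      exact ⟨_, hR.1, hR.2⟩

end Toolkit

/-- `NP ⊆ NTIME(2^{⌊n^{1/r}⌋})` for every `r ≥ 1`. [folklore] -/
theorem NP_subset_NTIME_two_pow_nthRoot {r : ℕ} (hr : r ≠ 0) :
    NP ⊆ NTIME (fun n => 2 ^ Nat.nthRoot r n) :=
  NP_subset_NTIME_of_poly_dominated fun q => PolyExistsNTIME.exists_poly_le_two_pow_nthRoot q hr

/-- `⌊n^{1/r}⌋ ≤ n^β` as reals when `1/r ≤ β` (`β > 0`, `r ≥ 1`). [folklore] -/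
theorem nthRoot_le_rpow {β : ℝ} (hβ : 0 < β) {r : ℕ} (hr : r ≠ 0) (hrβ : 1 / (r : ℝ) ≤ β) (n : ℕ) :
    (Nat.nthRoot r n : ℝ) ≤ (n : ℝ) ^ β := by
  have hpow : (Nat.nthRoot r n) ^ r ≤ n := Nat.pow_nthRoot_le (Or.inl hr)
  rcases Nat.eq_zero_or_pos n with rfl | hn
  · have h0 : Nat.nthRoot r 0 = 0 := by
      have : (Nat.nthRoot r 0) ^ r ≤ 0 := hpow
      exact pow_eq_zero_iff hr |>.1 (Nat.le_zero.1 this)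
    simp [h0, Real.zero_rpow hβ.ne']
  · have hn1 : (1 : ℝ) ≤ n := by exact_mod_cast hn
    have ha0 : (0 : ℝ) ≤ (Nat.nthRoot r n : ℝ) := Nat.cast_nonneg _
    calc (Nat.nthRoot r n : ℝ)
        = (((Nat.nthRoot r n : ℝ)) ^ r) ^ ((r : ℝ)⁻¹) := (Real.pow_rpow_inv_natCast ha0 hr).symm
      _ ≤ ((n : ℝ)) ^ ((r : ℝ)⁻¹) := by
          refine Real.rpow_le_rpow (by positivity) ?_ (by positivity)
          exact_mod_cast hpow
      _ = (n : ℝ) ^ (1 / (r : ℝ)) := by rw [one_div]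
      _ ≤ (n : ℝ) ^ β := Real.rpow_le_rpow_of_exponent_le hn1 hrβ

/-- `2^{⌊n^{1/r}⌋} ≤ ⌈2^{n^β}⌉ = subexpTime β n` when `1/r ≤ β`. [folklore] -/
theorem two_pow_nthRoot_le_subexpTime {β : ℝ} (hβ : 0 < β) {r : ℕ} (hr : r ≠ 0)
    (hrβ : 1 / (r : ℝ) ≤ β) (n : ℕ) : 2 ^ Nat.nthRoot r n ≤ subexpTime β n := by
  have h : ((2 ^ Nat.nthRoot r n : ℕ) : ℝ) ≤ (2 : ℝ) ^ ((n : ℝ) ^ β) := by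
    rw [Nat.cast_pow, Nat.cast_ofNat, ← Real.rpow_natCast]
    exact Real.rpow_le_rpow_of_exponent_le one_le_two (nthRoot_le_rpow hβ hr hrβ n)
  exact_mod_cast h.trans (Nat.le_ceil _)

/-- Every polynomial is `O(⌈2^{n^β}⌉)` (`β > 0`), through
`PolyExistsNTIME.exists_poly_le_two_pow_nthRoot` at `r = ⌈1/β⌉`. [folklore] -/
theorem exists_poly_le_subexpTime (q : Polynomial ℕ) {β : ℝ} (hβ : 0 < β) :
    ∃ b : ℕ, ∀ n, q.eval n ≤ b * subexpTime β n + b := by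
  set r : ℕ := ⌈1 / β⌉₊ with hrdef
  have hrpos : 0 < r := Nat.ceil_pos.2 (by positivity)
  have hr : r ≠ 0 := hrpos.ne'
  have hrβ : 1 / (r : ℝ) ≤ β := by
    have h1 : 1 / β ≤ (r : ℝ) := Nat.le_ceil _
    rw [div_le_iff₀ hβ] at h1
    rw [div_le_iff₀ (by exact_mod_cast hrpos)]
    linarith
  obtain ⟨C, hC⟩ := PolyExistsNTIME.exists_poly_le_two_pow_nthRoot q hr
  exact ⟨C, fun n => (hC n).trans (Nat.add_le_add_right
    (Nat.mul_le_mul_left C (two_pow_nthRoot_le_subexpTime hβ hr hrβ n)) C)⟩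

/-- **`NP ⊆ NTIME[2^{n^β}]`** (`= NTIME (subexpTime β)`) for every `β > 0`, in the tree's verifier
form. [folklore] -/
theorem NP_subset_NTIME_subexpTime {β : ℝ} (hβ : 0 < β) : NP ⊆ NTIME (subexpTime β) :=
  NP_subset_NTIME_of_poly_dominated fun q => exists_poly_le_subexpTime q hβ

/-- **Robust super-linear hardness ignores finitely many lengths**: if `L'` agrees with `L` at all
lengths `≥ N` and `L ∉ SIZE(c·⌈n^{1+ε}⌉ + c)` for every `c`, then the same holds for `L'` (the
circuit sizes of `L` below `N` are absorbed into the constant). [folklore] -/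
theorem forall_not_mem_SIZE_superlinearBound_of_agree {L L' : Language Bool} {N : ℕ} {ε : ℝ}
    (hagree : ∀ x : List Bool, N ≤ x.length → (x ∈ L ↔ x ∈ L'))
    (hH : ∀ c : ℕ, L ∉ SIZE (superlinearBound ε c)) : ∀ c : ℕ, L' ∉ SIZE (superlinearBound ε c) := by
  intro c hc
  set K : ℕ := ∑ n ∈ Finset.range N, L.circuitSize n with hK
  apply hH (c + K)
  rw [mem_SIZE_iff_circuitSize_le_holds] at hc ⊢
  intro n
  by_cases hn : N ≤ n
  · have hcs : L.circuitSize n = L'.circuitSize n :=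
      circuitSize_congr_of_agree fun x hx => hagree x (hx ▸ hn)
    rw [hcs]
    refine (hc n).trans ?_
    simp only [superlinearBound]
    nlinarith [Nat.zero_le (⌈(n : ℝ) ^ (1 + ε)⌉₊), Nat.zero_le K]
  · have hlt : n < N := not_le.1 hn
    have hle : L.circuitSize n ≤ K :=
      hK ▸ Finset.single_le_sum (f := fun n => L.circuitSize n) (fun _ _ => Nat.zero_le _)
        (Finset.mem_range.2 hlt)
    refine hle.trans ?_
    simp only [superlinearBound]
    nlinarith [Nat.zero_le (⌈(n : ℝ) ^ (1 + ε)⌉₊), Nat.zero_le c]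

/-- Restricting to lengths `≥ N` a language whose slices are small from `N` on gives a language
sparse at EVERY length (`ChenJinWilliams2019.IsSparse`). [folklore] -/
theorem isSparse_restrict {L : Language Bool} {e : ℕ → ℕ} {N : ℕ}
    (h : ∀ n, N ≤ n → {x : List Bool | x ∈ L ∧ x.length = n}.ncard ≤ e n) :
    IsSparse e (({x : List Bool | N ≤ x.length} : Language Bool) ⊓ L) := by
  set L' : Language Bool := ({x : List Bool | N ≤ x.length} : Language Bool) ⊓ L with hL'
  have hmem : ∀ x : List Bool, x ∈ L' ↔ N ≤ x.length ∧ x ∈ L := fun x => Iff.rfl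
  intro n
  have hsub : {x : List Bool | x ∈ L' ∧ x.length = n} ⊆ {x : List Bool | x ∈ L ∧ x.length = n} :=
    fun x hx => ⟨((hmem x).1 hx.1).2, hx.2⟩
  by_cases hn : N ≤ n
  · exact (Set.ncard_le_ncard hsub (Literature.Barriers.PneNP.finite_slice _ _)).trans (h n hn)
  · have hempty : {x : List Bool | x ∈ L' ∧ x.length = n} = ∅ := by
      ext x
      simp only [Set.mem_setOf_eq, Set.mem_empty_iff_false, iff_false, not_and]
      intro hx hlen
      exact hn (hlen ▸ ((hmem x).1 hx).1)
    rw [hempty, Set.ncard_empty]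
    exact Nat.zero_le _

/-- **The instantiation template, PROVED**: a language in `NP` that is eventually `2^{n^β}`-sparse
for every `β ∈ (0,1)` and robustly outside `SIZE[n^{1+ε}]` witnesses the Theorem-7 hypothesis
`SparseNSubexpHardAt ε` (with `β₀ = 1`; for each `β` the witness is `L` restricted to long lengths:
in `NP ⊆ NTIME[2^{n^β}]`, sparse at every length, equally hard). [folklore] -/
theorem sparseNSubexpHardAt_of_mem_NP {L : Language Bool} {ε : ℝ} (hNP : L ∈ NP)
    (hsp : ∀ β : ℝ, 0 < β → β < 1 →
      ∀ᶠ n : ℕ in atTop, {x : List Bool | x ∈ L ∧ x.length = n}.ncard ≤ expSparsity β n)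
    (hH : ∀ c : ℕ, L ∉ SIZE (superlinearBound ε c)) : SparseNSubexpHardAt ε := by
  refine ⟨1, one_pos, fun β hβ hβ1 => ?_⟩
  obtain ⟨N, hN⟩ := eventually_atTop.1 (hsp β hβ hβ1)
  refine ⟨({x : List Bool | N ≤ x.length} : Language Bool) ⊓ L, ?_, isSparse_restrict hN, ?_⟩
  · exact NP_subset_NTIME_subexpTime hβ
      (Literature.Algebra.EuclideanLattices.inter_P_mem_NP (setOf_le_length_mem_P _) hNP)
  · exact forall_not_mem_SIZE_superlinearBound_of_agree
      (fun x hx => ⟨fun h => ⟨hx, h⟩, fun h => h.2⟩) hH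

/-- Power-of-two slices control all slices of an `MCSP[s]` language (the others are empty).
[folklore] -/
theorem MCSPSize_eventually_sparse_of_pow_two (s : ℕ → ℕ) {e : ℕ → ℕ}
    (h : ∀ᶠ m : ℕ in atTop, {x : List Bool | x ∈ MCSPSize s ∧ x.length = 2 ^ m}.ncard ≤ e (2 ^ m)) :
    ∀ᶠ N : ℕ in atTop, {x : List Bool | x ∈ MCSPSize s ∧ x.length = N}.ncard ≤ e N := by
  obtain ⟨m₀, hm₀⟩ := eventually_atTop.1 h
  refine eventually_atTop.2 ⟨2 ^ m₀, fun N hN => ?_⟩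
  by_cases hpow : ∃ n : ℕ, N = 2 ^ n
  · obtain ⟨n, rfl⟩ := hpow
    have hn : m₀ ≤ n := by
      by_contra hlt
      exact absurd hN (not_le.2 (Nat.pow_lt_pow_right (by norm_num) (not_le.1 hlt)))
    exact hm₀ n hn
  · push Not at hpow
    rw [slice_MCSPSize_eq_empty (s := s) hpow, Set.ncard_empty]
    exact Nat.zero_le _

/-- **The remark IS Theorem 7 (⇐), given `MCSP[2^{⌊m/log⋆ m⌋}] ∈ NP`**: robust `n^{1+ε}` hardness
of `MCSPSize logStarExpSize` gives `SparseNSubexpHardAt ε` (sparsity proved above,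
`NP ⊆ NTIME[2^{n^β}]` proved above); the `NP`-membership is proved below
(`MCSPSize_logStarExpSize_mem_NP`; hypothesis-free form `sparseNSubexpHardAt_of_MCSP_logStar_holds`). [cite: ChenMcKayMurrayWilliams2019, remark after Thm. 7 and its proof, p. 30:5 / p. 30:15] -/
theorem sparseNSubexpHardAt_of_MCSP_logStar (hNP : MCSPSize logStarExpSize ∈ NP) {ε : ℝ}
    (hH : ∀ c : ℕ, MCSPSize logStarExpSize ∉ SIZE (superlinearBound ε c)) :
    SparseNSubexpHardAt ε :=
  sparseNSubexpHardAt_of_mem_NP hNP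
    (fun β hβ _ => MCSPSize_logStarExpSize_eventually_sparse β hβ) hH

/-- Hence `thm7_magnification` and `MCSP[2^{⌊m/log⋆ m⌋}] ∈ NP` give the vendored remark
`thm7_MCSP_remark`. [cite: ChenMcKayMurrayWilliams2019, remark after Thm. 7, p. 30:5 / p. 30:15] -/
theorem thm7_MCSP_remark_of_thm7 (hT : thm7_magnification) (hNP : MCSPSize logStarExpSize ∈ NP) :
    thm7_MCSP_remark :=
  fun ⟨ε, hε, hH⟩ => hT ⟨ε, hε, sparseNSubexpHardAt_of_MCSP_logStar hNP hH⟩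

/-- **The dyadic MCSP family witnesses Theorem 7's hypothesis, PROVED outright**: if for some `ε`
and every `j`, `MCSP[2^{⌊m/2^j⌋}] ∉ SIZE(c·⌈n^{1+ε}⌉ + c)` for all `c`, then `SparseNSubexpHardAt ε`
(for `β ∈ (0,1)` the witness is `MCSP[2^{⌊m/2^{j(β)}⌋}]` restricted to long lengths; its
`NP`-membership and eventual sparsity are the tree's `MCSPSize_mcspDyadic_mem_NP`,
`mcspFamilyEventuallySparse_dyadic`). [folklore] -/
theorem sparseNSubexpHardAt_of_MCSP_dyadic {ε : ℝ}
    (hH : ∀ j c : ℕ, MCSPSize (dyadicSize j) ∉ SIZE (superlinearBound ε c)) :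
    SparseNSubexpHardAt ε := by
  refine ⟨1, one_pos, fun β hβ hβ1 => ?_⟩
  have hsp := MCSPSize_eventually_sparse_of_pow_two _ (mcspFamilyEventuallySparse_dyadic β hβ hβ1)
  obtain ⟨N, hN⟩ := eventually_atTop.1 hsp
  refine ⟨({x : List Bool | N ≤ x.length} : Language Bool) ⊓ MCSPSize (mcspDyadic β), ?_,
    isSparse_restrict hN, ?_⟩
  · exact NP_subset_NTIME_subexpTime hβ
      (Literature.Algebra.EuclideanLattices.inter_P_mem_NP (setOf_le_length_mem_P _)
        (MCSPSize_mcspDyadic_mem_NP β))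
  · exact forall_not_mem_SIZE_superlinearBound_of_agree
      (fun x hx => ⟨fun h => ⟨hx, h⟩, fun h => h.2⟩) (hH (dyadicIndex β))

/-- **Theorem 7 at the dyadic MCSP family** (the analogue of the printed `MCSP` remark with the
tree's polynomial-time-computable thresholds `2^{⌊m/2^j⌋}` in place of `2^{m/log⋆ m}`): from the
vendored `thm7_magnification` ALONE, robust `n^{1+ε}`-size lower bounds for every
`MCSP[2^{⌊m/2^j⌋}]` imply `NEXP ⊄ P/poly`. [cite: ChenMcKayMurrayWilliams2019, Thm. 7 (⇐) instantiated as in the remark after it, p. 30:5] -/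
theorem thm7_at_MCSP_dyadic (hT : thm7_magnification) :
    (∃ ε : ℝ, 0 < ε ∧ ∀ j c : ℕ, MCSPSize (dyadicSize j) ∉ SIZE (superlinearBound ε c)) →
      ¬ (NEXP ⊆ PPoly) :=
  fun ⟨ε, hε, hH⟩ => hT ⟨ε, hε, sparseNSubexpHardAt_of_MCSP_dyadic hH⟩

/-! ### `MCSP[2^{⌊m/log⋆ m⌋}] ∈ NP` (PROVED): a polynomial-time `log⋆` brick

The reduction `w ↦ ⟨w, bin 2^{⌊m/log⋆ m⌋}⟩` (`m = ⌊log₂|w|⌋`) to `MCSP ∈ NP`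
(`MCSP_mem_NP_holds`), exactly as `ChenJinWilliams2019.dyadicRed` does for `2^{⌊m/2^j⌋}`, with one
new brick: `logStarFn 1ᵐ = 1^{log⋆ m}`, computed by iterating `m` times (`iterate_mem_FP`, additive
growth `5` per round) the round `lsRound` on records `⟨1ᵐ, ⟨1ᵛ, 1ᵃ⟩⟩` — "if `v ≤ 1` idle, else
`v ↦ ⌊log₂ v⌋` (`logFn`), `a ↦ a + 1`" — whose arithmetic model `lsModel` reaches
`(≤ 1, log⋆ m)` within `log⋆ m ≤ m` rounds; then `Plumb.divModFn` divides `1ᵐ` by it and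
`AvgNE.pow2NumF 1` writes `bin 2^{quotient}`. All [folklore] (Arora–Barak §1.3: bounded loops and
composition in polynomial time). -/

section LogStarNP
open _root_.Computability Literature.Computability.Complexity.Classes
open Literature.Computability.Complexity.Brick Literature.Computability.Complexity.Plumb Polynomial

/-- One round of the `log⋆` counter on records `⟨1ᵐ, ⟨1ᵛ, 1ᵃ⟩⟩`: if `v ≤ 1` keep the state,
else `v ↦ ⌊log₂ v⌋`, `a ↦ a + 1`. [folklore] -/
noncomputable def lsRound : List Bool → List Bool :=
  fanoutFn fstF (iteFn (lenLeOneFn ∘ nthF 1) sndF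
    (fanoutFn (logFn ∘ nthF 1) (List.cons true ∘ sndPow 1)))

/-- Value of `lsRound` on a state. [folklore] -/
theorem lsRound_state (m v a : ℕ) :
    lsRound (boolPair (ones m) (boolPair (ones v) (ones a))) =
      boolPair (ones m) (if v ≤ 1 then boolPair (ones v) (ones a)
        else boolPair (ones (Nat.log 2 v)) (ones (a + 1))) := by
  unfold lsRound
  have hc : (lenLeOneFn ∘ nthF 1) (boolPair (ones m) (boolPair (ones v) (ones a))) =
      [decide (v ≤ 1)] := by
    simp [lenLeOneFn, nthF, ones]
  by_cases h : v ≤ 1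
  · rw [fanoutFn_apply, iteFn_apply_true (by rw [hc, decide_eq_true h]), if_pos h]
    simp [fstF]
  · rw [fanoutFn_apply, iteFn_apply_false (by rw [hc, decide_eq_false h]), if_neg h]
    simp [fstF, nthF, sndPow, logFn, ones, List.replicate_succ]

/-- Additive growth of `lsRound` (on every input). [folklore] -/
theorem length_lsRound_le (w : List Bool) : (lsRound w).length ≤ w.length + 5 := by
  have h1 := length_fstF_sndF_le w
  have h2 := length_fstF_sndF_le (sndF w)
  have h3 : (logFn (fstF (sndF w))).length ≤ (fstF (sndF w)).length := by
    rw [length_logFn]; exact Nat.log_le_self 2 _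
  unfold lsRound
  rcases oneBit_lenLeOneFn (nthF 1 w) with ⟨b, hb⟩
  cases b
  · rw [fanoutFn_apply, iteFn_apply_false (by simpa using hb)]
    simp only [fanoutFn_apply, length_boolPair, Function.comp_apply, nthF, sndPow, fstF, sndF,
      List.length_cons] at h1 h2 h3 ⊢
    omega
  · rw [fanoutFn_apply, iteFn_apply_true (by simpa using hb)]
    simp only [length_boolPair, fstF, sndF] at h1 ⊢
    omega

/-- `lsRound ∈ FP`. [folklore] -/
theorem lsRound_mem_FP : lsRound ∈ FP :=
  fanoutFn_mem_FP fstF_mem_FP (iteFn_mem_FP (comp_mem_FP lenLeOneFn_mem_FP (nthF_mem_FP 1)) sndF_mem_FP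
    (fanoutFn_mem_FP (comp_mem_FP logFn_mem_FP (nthF_mem_FP 1))
      (comp_mem_FP (cons_mem_FP true) (sndPow_mem_FP 1))))

/-- The arithmetic model of `k` rounds on `(v, a)`. [folklore] -/
def lsModel : ℕ → ℕ × ℕ → ℕ × ℕ
  | 0, p => p
  | k + 1, p => lsModel k (if p.1 ≤ 1 then p else (Nat.log 2 p.1, p.2 + 1))

/-- `k` rounds of `lsRound` compute `lsModel k`. [folklore] -/
theorem iterate_lsRound (m : ℕ) : ∀ (k v a : ℕ),
    lsRound^[k] (boolPair (ones m) (boolPair (ones v) (ones a))) =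
      boolPair (ones m) (boolPair (ones (lsModel k (v, a)).1) (ones (lsModel k (v, a)).2))
  | 0, v, a => by simp [lsModel]
  | k + 1, v, a => by
    rw [Function.iterate_succ_apply, lsRound_state]
    by_cases h : v ≤ 1
    · rw [if_pos h, iterate_lsRound m k v a]
      simp [lsModel, h]
    · rw [if_neg h, iterate_lsRound m k (Nat.log 2 v) (a + 1)]
      simp [lsModel, h]

/-- After at least `log⋆ v` rounds the accumulator holds `a + log⋆ v` and the value is `≤ 1`.
[folklore] -/
theorem lsModel_spec : ∀ (k v a : ℕ), logStar v ≤ k →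
    (lsModel k (v, a)).2 = a + logStar v ∧ (lsModel k (v, a)).1 ≤ 1
  | 0, v, a, h => by
    have hv : v ≤ 1 := by
      by_contra hv
      rw [logStar_of_two_le (by omega)] at h
      omega
    simp [lsModel, logStar_of_le_one hv, hv]
  | k + 1, v, a, h => by
    by_cases hv : v ≤ 1
    · have := lsModel_spec k v a (by rw [logStar_of_le_one hv]; exact Nat.zero_le _)
      simp only [lsModel, if_pos hv]
      exact this
    · rw [logStar_of_two_le (by omega)] at h ⊢
      have := lsModel_spec k (Nat.log 2 v) (a + 1) (by omega)
      simp only [lsModel, if_neg hv]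
      exact ⟨by rw [this.1]; ring, this.2⟩

/-- `log⋆ m ≤ m`. [folklore] -/
theorem logStar_le_self (m : ℕ) : logStar m ≤ m := by
  have h := logStar_le_size_sub_one m
  have hs : Nat.size m ≤ m := Nat.size_le.2 (Nat.lt_two_pow_self)
  omega

/-- **The `log⋆` brick**: seed the record `⟨u, ⟨u, ε⟩⟩`, run `|u|` rounds of `lsRound`, read the
accumulator. [folklore] -/
noncomputable def logStarFn : List Bool → List Bool :=
  sndPow 1 ∘ (fun w => lsRound^[(X : Polynomial ℕ).eval (boolUnpair w).1.length] w) ∘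
    fanoutFn id (fanoutFn id (fun _ => []))

/-- `logStarFn 1ᵐ = 1^{log⋆ m}`. [folklore] -/
theorem logStarFn_ones (m : ℕ) : logStarFn (ones m) = ones (logStar m) := by
  have h0 : fanoutFn id (fanoutFn id (fun _ => [])) (ones m) =
      boolPair (ones m) (boolPair (ones m) (ones 0)) := by simp [ones]
  simp only [logStarFn, Function.comp_apply]
  rw [h0, boolUnpair_boolPair, eval_X]
  simp only [ones, List.length_replicate]
  have h := iterate_lsRound m m m 0
  simp only [ones] at h
  rw [h]
  have hs := lsModel_spec m m 0 (logStar_le_self m)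
  simp [sndPow, hs.1]

/-- **`logStarFn ∈ FP`** (`iterate_mem_FP`: `|u|` rounds of additive growth `5`).
[cite: AroraBarak2009, §1.3 (bounded loops and composition)] -/
theorem logStarFn_mem_FP : logStarFn ∈ FP :=
  comp_mem_FP (sndPow_mem_FP 1) (comp_mem_FP (iterate_mem_FP lsRound_mem_FP 5 length_lsRound_le X)
    (fanoutFn_mem_FP OracleCompose.id_mem_FP
      (fanoutFn_mem_FP OracleCompose.id_mem_FP (const_mem_FP []))))

/-- The reduction `w ↦ ⟨w, bin 2^{⌊m / log⋆ m⌋}⟩`, `m = ⌊log₂|w|⌋` (cf.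
`ChenJinWilliams2019.dyadicRed`). [folklore] -/
noncomputable def logStarRed : List Bool → List Bool :=
  fanoutFn id (AvgNE.pow2NumF 1 ∘ fstF ∘ divModFn ∘ fanoutFn (logStarFn ∘ logFn) logFn)

/-- `logStarRed ∈ FP`. [folklore] -/
theorem logStarRed_mem_FP : logStarRed ∈ FP :=
  fanoutFn_mem_FP OracleCompose.id_mem_FP (comp_mem_FP (AvgNE.pow2NumF_mem_FP 1)
    (comp_mem_FP fstF_mem_FP (comp_mem_FP divModFn_mem_FP
      (fanoutFn_mem_FP (comp_mem_FP logStarFn_mem_FP logFn_mem_FP) logFn_mem_FP))))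

/-- Value of the reduction: `logStarRed w = ⟨w, bin (logStarExpSize ⌊log₂|w|⌋)⟩`. [folklore] -/
theorem logStarRed_apply (w : List Bool) :
    logStarRed w = boolPair w (encodeNat (logStarExpSize (Nat.log 2 w.length))) := by
  have hnum : ∀ u : List Bool, AvgNE.pow2NumF 1 u = encodeNat (2 ^ u.length) := fun u => by
    have h := encodeNat_bitsToNat (isCanonicalNum_append_true (Kannan.zerosFn (onesMulFn 1 u)))
    rw [← AvgNE.pow2NumF, AvgNE.bitsToNat_pow2NumF, Nat.one_mul] at h
    exact h.symm
  have hlog : logFn w = ones (Nat.log 2 w.length) := rfl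
  simp only [logStarRed, fanoutFn_apply, id, Function.comp_apply, hnum, hlog, logStarFn_ones,
    divModFn_boolPair, fstF_boolPair, logStarExpSize]
  simp [ones]

/-- **`MCSP[2^{⌊m/log⋆ m⌋}] ∈ NP`** — preimage of `MCSP ∈ NP` (`MCSP_mem_NP_holds`) under
`logStarRed` (the proof of `ChenJinWilliams2019.MCSPSize_dyadicSize_mem_NP` verbatim).
[Kabanets–Cai 2000, §2] [cite: KabanetsCai2000, §2] -/
theorem MCSPSize_logStarExpSize_mem_NP : MCSPSize logStarExpSize ∈ NP := by
  have hpre : MCSPSize logStarExpSize = logStarRed ⁻¹' MCSP := by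
    ext w
    change w ∈ MCSPSize logStarExpSize ↔ logStarRed w ∈ MCSP
    rw [logStarRed_apply]
    constructor
    · rintro ⟨n, f, rfl, hf⟩
      rw [boolPair_truthTable_mem_MCSP_iff, length_truthTable, Nat.log_pow one_lt_two]
      exact hf
    · rintro ⟨m, g, t, hw, hg⟩
      have h1 : (w, encodeNat (logStarExpSize (Nat.log 2 w.length))) = (truthTable g, encodeNat t) :=
        boolPair_injective hw
      obtain ⟨rfl, h2⟩ := Prod.mk.inj h1
      have ht := congrArg decodeNat h2
      rw [decode_encodeNat, decode_encodeNat, length_truthTable, Nat.log_pow one_lt_two] at ht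
      refine ⟨m, g, rfl, ?_⟩
      rw [ht]
      exact hg
  rw [hpre]
  exact preimage_mem_NP MCSP_mem_NP_holds logStarRed_mem_FP

end LogStarNP

/-- Robust `n^{1+ε}` hardness of `MCSP[2^{⌊m/log⋆ m⌋}]` gives Theorem 7's hypothesis —
hypothesis-free form of `sparseNSubexpHardAt_of_MCSP_logStar`. [cite: ChenMcKayMurrayWilliams2019, remark after Thm. 7 and its proof, p. 30:5 / p. 30:15] -/
theorem sparseNSubexpHardAt_of_MCSP_logStar_holds {ε : ℝ}
    (hH : ∀ c : ℕ, MCSPSize logStarExpSize ∉ SIZE (superlinearBound ε c)) :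
    SparseNSubexpHardAt ε :=
  sparseNSubexpHardAt_of_MCSP_logStar MCSPSize_logStarExpSize_mem_NP hH

/-- **The vendored remark is DERIVED from Theorem 7 (⇐)**: `thm7_magnification → thm7_MCSP_remark`
(sparsity, `NP ⊆ NTIME[2^{n^β}]` and `MCSP[2^{⌊m/log⋆ m⌋}] ∈ NP` are all theorems of this file).
[cite: ChenMcKayMurrayWilliams2019, remark after Thm. 7, p. 30:5; proof p. 30:15] -/
theorem thm7_MCSP_remark_of_thm7_holds (hT : thm7_magnification) : thm7_MCSP_remark :=
  thm7_MCSP_remark_of_thm7 hT MCSPSize_logStarExpSize_mem_NP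

end Literature.Computability.MetaComplexity.ChenMcKayMurrayWilliams2019
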